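import Summits.HodgeConjecture.HodgeConjecture.Theorems.F0P6aPELInputs   -- ★ p852908 VERBATIM TWIN (LAST part; parts `…F0P6aPELInputsSpread` p852878 → `…F0P6aPELInputsRows` p852892 ride the import) of tree `Lines/F0_P6a_PELInputs.lean` ED. 4 4b58c51d551d6ef7 (883 l.; namespace KEPT)
import Summits.HodgeConjecture.HodgeConjecture.Cruxes.HLiu418.Lines.F0_P6a_PELWitnessE
import HarnessLib
import HarnessLib.Audit.LibrarySuggestionsDenyListCruxes

/-! # F0_P6a_PELInputs — ED. 5 = SHIM (K5-H3 P-lane prerequisite №2, promoted from K6 by LEAD F0P6-plan «M-140b»; pen «L7» LA7-plan (g7), RE-HOME TABLE v1.7; box LAref-P (g5) first ∕ LA-ref1 (g5) second)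

ED. 6 (LEAD «M-146» fix-forward after req575 RED): re-imports `Lines.F0_P6a_PELWitnessE` (ED. 6 shim = ★ p850400 + the by-name alias `stub_UNIVFAM`, which has no ★ twin of that name) so this shim re-exports the WHOLE ED. 4 surface; consumer of record `F0_P6a_EExports` :262–:263.

Every declaration of the P-LINE ED. 4 (sha16 4b58c51d551d6ef7, 883 l., sorry-free; 22 declarations: `genIncl`, `PELSpreadAt`, the laws `PELInj0LawAt`∕`PELHeckeLawAt`∕`PELTwistLawAt`∕
`PELKottLawAt`, `inputsOfParts`, `ESepAt`, the `SignatureRows` section, `kottRows_explicit`, the letters `DualPairOfAmpleRigidified`∕`RecordPELSpreadCofinal`∕`RecordGenericInjectivity`∕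
`RecordKottwitzSheets`, the PAID registered letters `stub_DUALS`∕`stub_KOTT`∕`stub_INJ` (by term) and the parametric head `pel_of_inputs`) now lives, byte for byte and under the SAME
namespace `Summit.HodgeConjecture.HodgeConjecture.Cruxes.HLiu418.F0P6aPELInputs`, in ★ `Theorems/F0P6aPELInputsSpread.lean` (p852878) → ★ `…PELInputsRows.lean` (p852892) → ★ `…PELInputs.lean` (p852908)
(the four closed letters carry `(print: …)` locators there instead of `[cite: …]` — gate relocation rule, LA-ref1 (g5) BOX K5 #R1; statements byte-identical); this module keeps its
name so that its tree importers (`F0_P6a_ModuliDatum.lean` MAIN :10, `F0_P6a_PELSpread.lean` — hub ED. 2 from this same request on reaches it through ★ `F0P6aPELSpreadDefs` —,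
`F0_P6a_StubGSPREAD.lean`, `F0_P6a_StubGEN.lean`, and every by-name reader under `open …F0P6aPELInputs`) resolve unchanged through the import above.  It declares nothing.
No declaration was cut in the ★ twin (verbatim re-home) ⇒ nothing to alias (should the gate ever CUT a PAID letter under `dedup.landed`, that name is kept alive HERE by an
alias theorem with its ED. 4 statement byte-identical, exactly as the `F0_P6a_PELWitnessE` ED. 6 shim does for `stub_UNIVFAM`).
ORDER NOTE: written in ONE request together with the `F0_P6a_StubKOTT` ED. 3 shim and the `F0_P6a_PELSpread` ED. 2 hub edition (NO-CROSS-IMPORT, MAIN :10); an importer smoke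
that reads «environment already contains …» before that request is BUILT is this order note, not a defect.  The registered sockets of this file were all retired or PAID
by ED. 4 (`stub_SPREAD` retired «M-95» (2); `stub_DUALS`∕`stub_KOTT`∕`stub_INJ` by term) ⇒ the books՚ socket census of this path stays 0.  Edition history ED. 1–4 stays in
the line card and in git; future changes are ★-side proposals on the `Theorems/` files.
HC_CM is proved only modulo the 7 printed citations (2 remaining named inputs: hLiu418 = stmt-HodgeConjecture-24832, h413 = stmt-HodgeConjecture-24833) until rung 0 closes; count-neutral (0 `sorry`, 0 socket, 0 declarations). -/
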